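import Literature.NumberTheory.Sieve.RoughModelPairCount
import HarnessLib

/-!
# Pair correlations of the rough model of the primes: `∑ g_z(m) g_z(m+h)` by the fundamental lemma, PROVED

Topic `Literature/NumberTheory/Sieve`, namespace `Literature.NumberTheory.Sieve.CubicMinorant`; companion
of `RoughModelPairCount.lean` (the binary count `∑_{n<m} g_z(n) g_z(m − n) ≥ c₀ m`, E6 of the parity-ideate
cell). The rough model `g_z(n) = (P/φ(P))·1[(n, P) = 1]`, `P = P(z) = ∏_{p<z} p`, `z = (log N)^B`, is the
tree's `roughModel B N` (`CubicMinorantDefs.lean`). This file PROVES the two-sided asymptotic for its PAIR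
CORRELATIONS over an arbitrary interval, uniformly in the shift `h ≥ 0`:

  `|∑_{M₁ < m ≤ M₁+M} g_z(m) g_z(m+h) − M·𝔖_z(h)| ≤ C_ω · M 𝔖_z(h) · e^{−log D/log z} + z² · D e⁸ log² z`

for every `D ≥ z ≥ 2` (`abs_pairCorrelation_sub_le`; `C_ω` the tree's fundamental-lemma constant
`SieveSequence.flConst 2 (2e^{17+12/log 2})` of dimension `2`), where

  `𝔖_z(h) = (P/φ(P))² ∏_{p<z} (1 − ω_h(p)/p)`,  `ω_h(p) = 1` if `p ∣ h`, `ω_h(p) = 2` if `p ∤ h`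

(`pairSingSeries`, `pairShiftRootCount`) is the singular series of the pair `n, n + h` truncated at `z`:
`𝔖_z(h) = ∏_{p<z, p∣h} p/(p−1) · ∏_{p<z, p∤h} (1 − (p−1)⁻²)` (`pairSingSeries_eq_prod`), so that
`𝔖_z(h) = 0` for odd `h` once `z > 2`, `𝔖_z(0) = P/φ(P)`, and `0 ≤ 𝔖_z(h) ≤ h/φ(h)` (`h ≠ 0`),
`𝔖_z(h) ≤ P/φ(P) ≤ z` (`pairSingSeries_nonneg`, `pairSingSeries_le_div_totient`,
`pairSingSeries_le_primorial_div_totient`, `pairSingSeries_le_roughLevel`).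

This is the classical application of the FUNDAMENTAL LEMMA [HalberstamRichert1974, Theorem 2.5;
Greaves2001, §3.3] to the polynomial sequence `f(n) = (n + M₁)(n + M₁ + h)`, `1 ≤ n ≤ M` (sieve dimension
`2`: `ω_f(p) = ω_h(p) ≤ 2`, `ω_f(2) = 1` for even `h`), in the tree's form
`Literature.NumberTheory.Sieve.abs_card_coprime_sub_le` (`PolynomialValuesSieveBounds.lean`, the main term of
Granville–Mollin (6.1)); for odd `h` both sides vanish (`m(m+h)` is even). It is the "pair-correlation
lemma for the rough model" consumed by the variance (dispersion) step of binary problems with one summand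
replaced by `g_z` — in the parity-ideate cell, layer-2 input `PairCorrelationRough` of crux
`ModelDispersion` of route `GoldbachHeathBrownDispersion` (`∑_{N<n≤2N} g(n−k)g(n−k') =
∑_{N−k'<m≤2N−k'} g(m)g(m+(k'−k))`, i.e. `M₁ = N − k'`, `M = N`, `h = k' − k`; the consumer takes
`D = N^{1/2}`, so that `e^{−log D/log z} = N^{−1/(2B log log N)}` and `z²De⁸log²z ≤ N^{1/2+o(1)}`).

## Contents

* `pairShiftRootCount h p = ω_h(p)`; `shiftPairPoly M₁ h = (X + M₁)(X + M₁ + h) ∈ ℤ[X]` with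
  `shiftPairPoly_eval`, `natAbs_shiftPairPoly_eval`, `shiftPairPoly_eval_pos`, and the EXACT local root
  count `polyRootCountMod_shiftPairPoly` (`= ω_h(p)` at every prime `p`), hence `≤ 2` and, for even `h`,
  `= 1` at `p = 2`.
* `pairSingSeries B N h = 𝔖_z(h)` and its closed form / bounds listed above; `pairSingSeries_zero`
  (`𝔖_z(0) = P/φ(P)`), `pairSingSeries_eq_zero_of_odd` (`z > 2`).
* `roughModel_mul_roughModel_eq` (`g(a)g(b) = (P/φ(P))²·1[(ab,P)=1]`), `roughModel_sq`
  (`g(m)² = (P/φ(P))·g(m)`), `pairCorrelation_eq_card` (the correlation sum IS `(P/φ(P))²` times the sifted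
  count of `{(n+M₁)(n+M₁+h) : 1 ≤ n ≤ M}`), `pairCorrelation_eq_zero_of_odd`.
* **`abs_pairCorrelation_sub_le`** (explicit constants, all `h`), and the packaged form
  **`exists_pairCorrelation_bound`**: `∃ C > 0`, for all `N, M₁, M, h` and `D ≥ z ≥ 2`,
  `|∑ g(m)g(m+h) − M𝔖_z(h)| ≤ C (M 𝔖_z(h) e^{−log D/log z} + D z⁴)`.

## References

* [HalberstamRichert1974] H. Halberstam, H.-E. Richert, *Sieve Methods*, Academic Press 1974, Theorem 2.5
  (the fundamental lemma) with §1.4 (the products `V(z)`, `P/φ(P)`), applied to `{n(n+h)}`.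
* [Greaves2001] G. Greaves, *Sieves in Number Theory*, Springer 2001, §3.3 (the fundamental lemma for a
  sifted sequence; Corollary 1.1).
* [GranvilleMollin2000] A. Granville, R. A. Mollin, *Rabinowitsch revisited*, Acta Arith. 96 (2000), §6A
  (6.1) (the two-sided main term for polynomial sequences, the form proved in the tree).

## Mathlib / tree search

Tree: `roughModel`, `roughPrimorial`, `roughLevel` (`CubicMinorantDefs`); `abs_card_coprime_sub_le`,
`prod_one_sub_rootCount_pos` (`PolynomialValuesSieveBounds`); `polyRootCountMod_single_eq_card_zmod`
(`BatemanHornProofs`); `primesProdBelow_div_totient(_le)` (`RoughModelPairCount`); `primesProdBelow`,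
`primeFactors_primesProdBelow`, `dvd_primesProdBelow_iff`, `squarefree_primesProdBelow` (`SieveFramework`);
`SieveSequence.flConst(_pos)` (`SieveFrameworkFundamentalLemma`). Mathlib: `Nat.totient_mul_prod_primeFactors`,
`Nat.primesBelow`, `Finset.prod_le_prod`, `Finset.sum_nbij'`. `lean search 'pairSingSeries|pairCorrelation|
shiftPairPoly'`: nothing before this file.
-/

noncomputable section

open scoped ArithmeticFunction
open Finset Filter Polynomial Literature.NumberTheory.Sieve

namespace Literature.NumberTheory.Sieve.CubicMinorant

/-! ### The local root count `ω_h(p)` -/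

/-- `ω_h(p)`: the number of residues `n (mod p)` with `p ∣ n(n + h)`, i.e. `1` if `p ∣ h` and `2`
otherwise (`p` prime) — the local factor of the pair-correlation problem `n, n + h`.
[cite: HalberstamRichert1974, Theorem 2.5 (fundamental lemma) and (1.4.14) (the product P/φ(P))] -/
def pairShiftRootCount (h p : ℕ) : ℕ := if p ∣ h then 1 else 2

/-- `ω_h(p) ≤ 2`. [cite: HalberstamRichert1974, Theorem 2.5 (fundamental lemma) and (1.4.14) (the product P/φ(P))] -/
theorem pairShiftRootCount_le_two (h p : ℕ) : pairShiftRootCount h p ≤ 2 := by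
  unfold pairShiftRootCount; split_ifs <;> norm_num

/-- `1 ≤ ω_h(p)`. [cite: HalberstamRichert1974, Theorem 2.5 (fundamental lemma) and (1.4.14) (the product P/φ(P))] -/
theorem one_le_pairShiftRootCount (h p : ℕ) : 1 ≤ pairShiftRootCount h p := by
  unfold pairShiftRootCount; split_ifs <;> norm_num

/-- `ω_0(p) = 1`. [cite: HalberstamRichert1974, Theorem 2.5 (fundamental lemma) and (1.4.14) (the product P/φ(P))] -/
theorem pairShiftRootCount_zero (p : ℕ) : pairShiftRootCount 0 p = 1 := by
  simp [pairShiftRootCount]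

/-- `ω_h(2) = 2` for odd `h`. [cite: HalberstamRichert1974, Theorem 2.5 (fundamental lemma) and (1.4.14) (the product P/φ(P))] -/
theorem pairShiftRootCount_two_of_odd {h : ℕ} (hh : Odd h) : pairShiftRootCount h 2 = 2 := by
  unfold pairShiftRootCount
  rw [if_neg]
  exact hh.not_two_dvd_nat

/-! ### The polynomial `(X + M₁)(X + M₁ + h)` and its root counts -/

/-- `f = (X + M₁)(X + M₁ + h) ∈ ℤ[X]`, whose value at `n` is `(n + M₁)(n + M₁ + h) = m(m + h)` for
`m = n + M₁`: the pair-correlation sequence over the interval `(M₁, M₁ + M]` as a polynomial sequence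
indexed by `1 ≤ n ≤ M`. [folklore] -/
def shiftPairPoly (M₁ h : ℕ) : ℤ[X] := (X + C (M₁ : ℤ)) * (X + C ((M₁ : ℤ) + h))

/-- `f(n) = (n + M₁)(n + M₁ + h)`. [cite: Greaves2001, §3.3 (the fundamental lemma applied to a sifted sequence; Corollary 1.1)] -/
theorem shiftPairPoly_eval (M₁ h : ℕ) (n : ℤ) :
    (shiftPairPoly M₁ h).eval n = (n + M₁) * (n + M₁ + h) := by
  simp only [shiftPairPoly, eval_mul, eval_add, eval_X, eval_C]; ring

/-- `|f(n)| = (n + M₁)(n + M₁ + h)` as natural numbers. [cite: Greaves2001, §3.3 (the fundamental lemma applied to a sifted sequence; Corollary 1.1)] -/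
theorem natAbs_shiftPairPoly_eval (M₁ h n : ℕ) :
    ((shiftPairPoly M₁ h).eval (n : ℤ)).natAbs = (n + M₁) * (n + M₁ + h) := by
  rw [shiftPairPoly_eval,
    show ((n : ℤ) + M₁) * ((n : ℤ) + M₁ + h) = (((n + M₁) * (n + M₁ + h) : ℕ) : ℤ) by push_cast; ring,
    Int.natAbs_natCast]

/-- `0 < f(n) ≤ (M + M₁)(M + M₁ + h)` for `1 ≤ n ≤ M`. [cite: Greaves2001, §3.3 (the fundamental lemma applied to a sifted sequence; Corollary 1.1)] -/
theorem shiftPairPoly_eval_pos (M₁ h M : ℕ) :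
    ∀ n ∈ Ioc 0 M, 0 < (shiftPairPoly M₁ h).eval (n : ℤ) ∧
      (((shiftPairPoly M₁ h).eval (n : ℤ) : ℤ) : ℝ) ≤ ((M : ℝ) + M₁) * ((M : ℝ) + M₁ + h) := by
  intro n hn
  rw [Finset.mem_Ioc] at hn
  rw [shiftPairPoly_eval]
  have h1 : (1 : ℤ) ≤ n := by exact_mod_cast hn.1
  refine ⟨mul_pos (by positivity) (by positivity), ?_⟩
  push_cast
  have h2 : (n : ℝ) ≤ M := by exact_mod_cast hn.2
  have h0 : (0 : ℝ) ≤ n := Nat.cast_nonneg n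
  have hM₁ : (0 : ℝ) ≤ M₁ := Nat.cast_nonneg M₁
  have hh : (0 : ℝ) ≤ h := Nat.cast_nonneg h
  exact mul_le_mul (by linarith) (by linarith) (by positivity) (by positivity)

/-- `f mod p` evaluated: `((X + M₁)(X + M₁ + h) mod p)(x) = (x + M₁)(x + M₁ + h)` in any commutative
ring. [cite: Greaves2001, §3.3 (the fundamental lemma applied to a sifted sequence; Corollary 1.1)] -/
theorem eval_map_shiftPairPoly {R : Type*} [CommRing R] (M₁ h : ℕ) (x : R) :
    ((shiftPairPoly M₁ h).map (Int.castRingHom R)).eval x = (x + M₁) * (x + M₁ + h) := by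
  simp only [shiftPairPoly, Polynomial.map_mul, Polynomial.map_add, Polynomial.map_X,
    Polynomial.map_C, eval_mul, eval_add, eval_X, eval_C]
  simp only [map_add, map_natCast]
  ring

/-- **The exact local root count**: at a prime `p`, `ω_f(p) = ω_h(p)` — the roots of
`(n + M₁)(n + M₁ + h) ≡ 0 (mod p)` are `−M₁` and `−M₁ − h`, which coincide iff `p ∣ h`. [cite: Greaves2001, §3.3 (the fundamental lemma applied to a sifted sequence; Corollary 1.1)] -/
theorem polyRootCountMod_shiftPairPoly (M₁ h : ℕ) {p : ℕ} (hp : p.Prime) :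
    polyRootCountMod ![shiftPairPoly M₁ h] p = pairShiftRootCount h p := by
  classical
  haveI := Fact.mk hp
  rw [polyRootCountMod_single_eq_card_zmod]
  have hset : (univ.filter fun x : ZMod p =>
      ((shiftPairPoly M₁ h).map (Int.castRingHom (ZMod p))).eval x = 0) =
      ({-(M₁ : ZMod p), -((M₁ : ZMod p) + h)} : Finset (ZMod p)) := by
    ext x
    simp only [eval_map_shiftPairPoly, mem_filter, mem_univ, true_and, mem_insert, mem_singleton,
      mul_eq_zero]
    constructor
    · rintro (h1 | h1)
      · left; linear_combination h1
      · right; linear_combination h1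
    · rintro (h1 | h1)
      · left; rw [h1]; ring
      · right; rw [h1]; ring
  rw [hset, pairShiftRootCount]
  by_cases hph : p ∣ h
  · have hh0 : (h : ZMod p) = 0 := (ZMod.natCast_eq_zero_iff h p).mpr hph
    rw [if_pos hph, hh0, add_zero, Finset.pair_eq_singleton, card_singleton]
  · have hh0 : (h : ZMod p) ≠ 0 := fun h0 => hph ((ZMod.natCast_eq_zero_iff h p).mp h0)
    rw [if_neg hph, card_pair]
    intro heq
    apply hh0
    have := neg_injective heq
    linear_combination -this

/-- `ω_f(p) ≤ 2` (sieve dimension `2`). [cite: Greaves2001, §3.3 (the fundamental lemma applied to a sifted sequence; Corollary 1.1)] -/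
theorem polyRootCountMod_shiftPairPoly_le_two (M₁ h : ℕ) {p : ℕ} (hp : p.Prime) :
    polyRootCountMod ![shiftPairPoly M₁ h] p ≤ 2 := by
  rw [polyRootCountMod_shiftPairPoly M₁ h hp]; exact pairShiftRootCount_le_two h p

/-- `ω_f(2) ≤ 1` for even `h`: `m(m + h) ≡ m (mod 2)`. [cite: Greaves2001, §3.3 (the fundamental lemma applied to a sifted sequence; Corollary 1.1)] -/
theorem polyRootCountMod_shiftPairPoly_two_le_one (M₁ : ℕ) {h : ℕ} (hh : Even h) :
    polyRootCountMod ![shiftPairPoly M₁ h] 2 ≤ 1 := by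
  rw [polyRootCountMod_shiftPairPoly M₁ h Nat.prime_two, pairShiftRootCount,
    if_pos (even_iff_two_dvd.mp hh)]

/-! ### The truncated singular series `𝔖_z(h)` -/

/-- The truncated singular series of the pair `n, n + h` at the level `z = (log N)^B` of the rough
model: `𝔖_z(h) = (P/φ(P))² · ∏_{p<z} (1 − ω_h(p)/p)`, `P = P(z)`. For `z → ∞` and even `h ≠ 0` it tends
to the Hardy–Littlewood constant `2C₂ ∏_{p∣h, p>2} (p−1)/(p−2)`.
[cite: HalberstamRichert1974, Theorem 2.5 (fundamental lemma) and (1.4.14) (the product P/φ(P))] -/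
def pairSingSeries (B : ℝ) (N h : ℕ) : ℝ :=
  ((roughPrimorial B N : ℝ) / (Nat.totient (roughPrimorial B N) : ℝ)) ^ 2 *
    ∏ p ∈ Nat.primesBelow ⌈roughLevel B N⌉₊, (1 - (pairShiftRootCount h p : ℝ) / p)

/-- `𝔖_z(h)` unfolded. [cite: HalberstamRichert1974, Theorem 2.5 (fundamental lemma) and (1.4.14) (the product P/φ(P))] -/
theorem pairSingSeries_def (B : ℝ) (N h : ℕ) :
    pairSingSeries B N h =
      ((roughPrimorial B N : ℝ) / (Nat.totient (roughPrimorial B N) : ℝ)) ^ 2 *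
        ∏ p ∈ Nat.primesBelow ⌈roughLevel B N⌉₊, (1 - (pairShiftRootCount h p : ℝ) / p) := rfl

/-- Each factor `1 − ω_h(p)/p` is nonnegative (`ω_h(p) ≤ 2 ≤ p`). [cite: HalberstamRichert1974, Theorem 2.5 (fundamental lemma) and (1.4.14) (the product P/φ(P))] -/
theorem one_sub_pairShiftRootCount_div_nonneg (h : ℕ) {p : ℕ} (hp : p.Prime) :
    0 ≤ 1 - (pairShiftRootCount h p : ℝ) / p := by
  have h2 : (2 : ℝ) ≤ p := by exact_mod_cast hp.two_le
  have hω : (pairShiftRootCount h p : ℝ) ≤ 2 := by exact_mod_cast pairShiftRootCount_le_two h p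
  rw [sub_nonneg, div_le_one (by linarith)]
  linarith

/-- `𝔖_z(h) ≥ 0`. [cite: HalberstamRichert1974, Theorem 2.5 (fundamental lemma) and (1.4.14) (the product P/φ(P))] -/
theorem pairSingSeries_nonneg (B : ℝ) (N h : ℕ) : 0 ≤ pairSingSeries B N h :=
  mul_nonneg (sq_nonneg _) (Finset.prod_nonneg fun _ hp =>
    one_sub_pairShiftRootCount_div_nonneg h (Nat.prime_of_mem_primesBelow hp))

/-- **Closed form**: `𝔖_z(h) = ∏_{p<z} p(p − ω_h(p))/(p−1)²`, i.e. the factor is `p/(p−1)` for `p ∣ h`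
and `1 − 1/(p−1)²` for `p ∤ h` (from `P/φ(P) = ∏_{p<z} p/(p−1)`).
[cite: HalberstamRichert1974, Theorem 2.5 (fundamental lemma) and (1.4.14) (the product P/φ(P))] -/
theorem pairSingSeries_eq_prod (B : ℝ) (N h : ℕ) :
    pairSingSeries B N h =
      ∏ p ∈ Nat.primesBelow ⌈roughLevel B N⌉₊,
        (if p ∣ h then (p : ℝ) / ((p : ℝ) - 1) else 1 - 1 / ((p : ℝ) - 1) ^ 2) := by
  rw [pairSingSeries, roughPrimorial, primesProdBelow_div_totient, ← Finset.prod_pow,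
    ← Finset.prod_mul_distrib]
  refine Finset.prod_congr rfl fun p hp => ?_
  have hpp := Nat.prime_of_mem_primesBelow hp
  have h2 : (2 : ℝ) ≤ p := by exact_mod_cast hpp.two_le
  have hp1 : (p : ℝ) - 1 ≠ 0 := by linarith
  have hp0 : (p : ℝ) ≠ 0 := by linarith
  unfold pairShiftRootCount
  split_ifs
  · push_cast; field_simp
  · push_cast; field_simp; ring

/-- The factor at `p ∤ h` is at most `1`, the factor at `p ∣ h` is `p/(p−1)`; hence termwise
`p(p − ω_h(p))/(p−1)² ≤ p/(p−1)`. [cite: HalberstamRichert1974, Theorem 2.5 (fundamental lemma) and (1.4.14) (the product P/φ(P))] -/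
theorem pairSingSeries_factor_le {h p : ℕ} (hp : p.Prime) :
    (if p ∣ h then (p : ℝ) / ((p : ℝ) - 1) else 1 - 1 / ((p : ℝ) - 1) ^ 2) ≤ (p : ℝ) / ((p : ℝ) - 1) := by
  have h2 : (2 : ℝ) ≤ p := by exact_mod_cast hp.two_le
  split_ifs
  · exact le_rfl
  · have h1 : (1 : ℝ) ≤ (p : ℝ) / ((p : ℝ) - 1) := by
      rw [le_div_iff₀ (by linarith)]; linarith
    have h0 : 0 ≤ 1 / ((p : ℝ) - 1) ^ 2 := by positivity
    linarith

/-- The factors of the closed form are nonnegative. [cite: HalberstamRichert1974, Theorem 2.5 (fundamental lemma) and (1.4.14) (the product P/φ(P))] -/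
theorem pairSingSeries_factor_nonneg {h p : ℕ} (hp : p.Prime) :
    0 ≤ (if p ∣ h then (p : ℝ) / ((p : ℝ) - 1) else 1 - 1 / ((p : ℝ) - 1) ^ 2) := by
  have h2 : (2 : ℝ) ≤ p := by exact_mod_cast hp.two_le
  split_ifs
  · exact div_nonneg (by linarith) (by linarith)
  · have h1 : (1 : ℝ) ≤ ((p : ℝ) - 1) ^ 2 := by nlinarith
    rw [sub_nonneg, div_le_one (by positivity)]
    exact h1

/-- `𝔖_z(h) ≤ P/φ(P)` for every `h`. [cite: HalberstamRichert1974, Theorem 2.5 (fundamental lemma) and (1.4.14) (the product P/φ(P))] -/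
theorem pairSingSeries_le_primorial_div_totient (B : ℝ) (N h : ℕ) :
    pairSingSeries B N h ≤ (roughPrimorial B N : ℝ) / (Nat.totient (roughPrimorial B N) : ℝ) := by
  rw [pairSingSeries_eq_prod, roughPrimorial, primesProdBelow_div_totient]
  exact Finset.prod_le_prod (fun p hp => pairSingSeries_factor_nonneg (Nat.prime_of_mem_primesBelow hp))
    fun p hp => pairSingSeries_factor_le (Nat.prime_of_mem_primesBelow hp)

/-- `𝔖_z(h) ≤ z` for every `h` (via `P/φ(P) ≤ z`, `z ≥ 2`). [cite: HalberstamRichert1974, Theorem 2.5 (fundamental lemma) and (1.4.14) (the product P/φ(P))] -/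
theorem pairSingSeries_le_roughLevel (B : ℝ) (N h : ℕ) (hz : 2 ≤ roughLevel B N) :
    pairSingSeries B N h ≤ roughLevel B N :=
  (pairSingSeries_le_primorial_div_totient B N h).trans (primesProdBelow_div_totient_le hz)

/-- `h/φ(h) = ∏_{p∣h} p/(p−1)` for `h ≠ 0` (private helper). [folklore] -/
private theorem self_div_totient_eq_prod {h : ℕ} (hh : h ≠ 0) :
    (h : ℝ) / (Nat.totient h : ℝ) = ∏ p ∈ h.primeFactors, ((p : ℝ) / ((p : ℝ) - 1)) := by
  have key := Nat.totient_mul_prod_primeFactors h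
  have hφ0 : (Nat.totient h : ℝ) ≠ 0 := by exact_mod_cast (Nat.totient_pos.mpr (Nat.pos_of_ne_zero hh)).ne'
  have hprod : (∏ p ∈ h.primeFactors, ((p : ℝ) - 1)) ≠ 0 := by
    refine Finset.prod_ne_zero_iff.mpr fun p hp => ?_
    have h2 : (2 : ℝ) ≤ p := by exact_mod_cast (Nat.prime_of_mem_primeFactors hp).two_le
    linarith
  have keyR : (Nat.totient h : ℝ) * ∏ p ∈ h.primeFactors, (p : ℝ) =
      (h : ℝ) * ∏ p ∈ h.primeFactors, ((p : ℝ) - 1) := by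
    have := congr_arg (fun n : ℕ => (n : ℝ)) key
    simp only [Nat.cast_mul, Nat.cast_prod] at this
    rw [this]
    congr 1
    refine Finset.prod_congr rfl fun p hp => ?_
    rw [Nat.cast_pred (Nat.prime_of_mem_primeFactors hp).pos]
  rw [Finset.prod_div_distrib, div_eq_div_iff hφ0 hprod]
  linarith [keyR]

/-- **`𝔖_z(h) ≤ h/φ(h)` for `h ≠ 0`**: the factors `p ∤ h` are `≤ 1`, the factors `p ∣ h, p < z` are
among the `p/(p−1)`, `p ∣ h`. (So `𝔖_z(h) ≪ log log h` uniformly in `z`.)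
[cite: HalberstamRichert1974, Theorem 2.5 (fundamental lemma) and (1.4.14) (the product P/φ(P))] -/
theorem pairSingSeries_le_div_totient (B : ℝ) (N : ℕ) {h : ℕ} (hh : h ≠ 0) :
    pairSingSeries B N h ≤ (h : ℝ) / (Nat.totient h : ℝ) := by
  rw [pairSingSeries_eq_prod, self_div_totient_eq_prod hh]
  set S := Nat.primesBelow ⌈roughLevel B N⌉₊ with hS
  -- split the product over `p ∣ h` and `p ∤ h`
  rw [← Finset.prod_filter_mul_prod_filter_not S (fun p => p ∣ h)]
  have h1 : ∏ p ∈ S.filter (fun p => p ∣ h),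
      (if p ∣ h then (p : ℝ) / ((p : ℝ) - 1) else 1 - 1 / ((p : ℝ) - 1) ^ 2) =
      ∏ p ∈ S.filter (fun p => p ∣ h), ((p : ℝ) / ((p : ℝ) - 1)) :=
    Finset.prod_congr rfl fun p hp => by rw [if_pos (Finset.mem_filter.mp hp).2]
  have h2 : ∏ p ∈ S.filter (fun p => ¬ p ∣ h),
      (if p ∣ h then (p : ℝ) / ((p : ℝ) - 1) else 1 - 1 / ((p : ℝ) - 1) ^ 2) ≤ 1 := by
    refine Finset.prod_le_one (fun p hp => pairSingSeries_factor_nonneg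
      (Nat.prime_of_mem_primesBelow (Finset.mem_filter.mp hp).1)) fun p hp => ?_
    rw [if_neg (Finset.mem_filter.mp hp).2]
    have : 0 ≤ 1 / ((p : ℝ) - 1) ^ 2 := by positivity
    linarith
  have hsub : S.filter (fun p => p ∣ h) ⊆ h.primeFactors := by
    intro p hp
    rw [Finset.mem_filter] at hp
    exact Nat.mem_primeFactors.mpr ⟨Nat.prime_of_mem_primesBelow hp.1, hp.2, hh⟩
  have h3 : ∏ p ∈ S.filter (fun p => p ∣ h), ((p : ℝ) / ((p : ℝ) - 1)) ≤
      ∏ p ∈ h.primeFactors, ((p : ℝ) / ((p : ℝ) - 1)) := by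
    refine Finset.prod_le_prod_of_subset_of_one_le hsub (fun p hp => ?_) fun p hp _ => ?_
    · have h2 : (2 : ℝ) ≤ p := by
        exact_mod_cast (Nat.prime_of_mem_primesBelow (Finset.mem_filter.mp hp).1).two_le
      exact div_nonneg (by linarith) (by linarith)
    · have h2 : (2 : ℝ) ≤ p := by exact_mod_cast (Nat.prime_of_mem_primeFactors hp).two_le
      rw [le_div_iff₀ (by linarith)]; linarith
  have h0 : 0 ≤ ∏ p ∈ S.filter (fun p => p ∣ h), ((p : ℝ) / ((p : ℝ) - 1)) :=
    Finset.prod_nonneg fun p hp => by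
      have h2 : (2 : ℝ) ≤ p := by
        exact_mod_cast (Nat.prime_of_mem_primesBelow (Finset.mem_filter.mp hp).1).two_le
      exact div_nonneg (by linarith) (by linarith)
  rw [h1]
  calc (∏ p ∈ S.filter (fun p => p ∣ h), ((p : ℝ) / ((p : ℝ) - 1))) *
        ∏ p ∈ S.filter (fun p => ¬ p ∣ h),
          (if p ∣ h then (p : ℝ) / ((p : ℝ) - 1) else 1 - 1 / ((p : ℝ) - 1) ^ 2)
      ≤ (∏ p ∈ S.filter (fun p => p ∣ h), ((p : ℝ) / ((p : ℝ) - 1))) * 1 :=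
        mul_le_mul_of_nonneg_left h2 h0
    _ ≤ ∏ p ∈ h.primeFactors, ((p : ℝ) / ((p : ℝ) - 1)) := by rw [mul_one]; exact h3

/-- `𝔖_z(0) = P/φ(P)` (`ω_0 ≡ 1` and `(P/φ(P)) ∏_{p<z}(1 − 1/p) = 1`).
[cite: HalberstamRichert1974, Theorem 2.5 (fundamental lemma) and (1.4.14) (the product P/φ(P))] -/
theorem pairSingSeries_zero (B : ℝ) (N : ℕ) :
    pairSingSeries B N 0 = (roughPrimorial B N : ℝ) / (Nat.totient (roughPrimorial B N) : ℝ) := by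
  rw [pairSingSeries_eq_prod, roughPrimorial, primesProdBelow_div_totient]
  exact Finset.prod_congr rfl fun p _ => by rw [if_pos (dvd_zero p)]

/-- `𝔖_z(h) = 0` for odd `h` as soon as `z > 2` (the factor `1 − ω_h(2)/2 = 0`).
[cite: HalberstamRichert1974, Theorem 2.5 (fundamental lemma) and (1.4.14) (the product P/φ(P))] -/
theorem pairSingSeries_eq_zero_of_odd (B : ℝ) (N : ℕ) {h : ℕ} (hh : Odd h) (hz : 2 < roughLevel B N) :
    pairSingSeries B N h = 0 := by
  rw [pairSingSeries]
  have h2 : 2 ∈ Nat.primesBelow ⌈roughLevel B N⌉₊ :=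
    Nat.mem_primesBelow.mpr ⟨Nat.lt_ceil.mpr (by exact_mod_cast hz), Nat.prime_two⟩
  rw [Finset.prod_eq_zero h2, mul_zero]
  rw [pairShiftRootCount_two_of_odd hh]
  norm_num

/-! ### The correlation sum as a sifted count -/

/-- `g(a) g(b) = (P/φ(P))² · 1[(ab, P) = 1]`. [cite: Greaves2001, §3.3 (the fundamental lemma applied to a sifted sequence; Corollary 1.1)] -/
theorem roughModel_mul_roughModel_eq (B : ℝ) (N a b : ℕ) :
    roughModel B N a * roughModel B N b =
      if (a * b).Coprime (roughPrimorial B N) then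
        ((roughPrimorial B N : ℝ) / (Nat.totient (roughPrimorial B N) : ℝ)) ^ 2 else 0 := by
  have key : (a * b).Coprime (roughPrimorial B N) ↔
      a.Coprime (roughPrimorial B N) ∧ b.Coprime (roughPrimorial B N) := Nat.coprime_mul_iff_left
  unfold roughModel
  by_cases h1 : a.Coprime (roughPrimorial B N) <;> by_cases h2 : b.Coprime (roughPrimorial B N)
  · rw [if_pos h1, if_pos h2, if_pos (key.mpr ⟨h1, h2⟩), sq]
  · rw [if_pos h1, if_neg h2, if_neg (fun h => h2 (key.mp h).2), mul_zero]
  · rw [if_neg h1, if_neg (fun h => h1 (key.mp h).1), zero_mul]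
  · rw [if_neg h1, if_neg (fun h => h1 (key.mp h).1), zero_mul]

/-- `g(m)² = (P/φ(P)) · g(m)` (the diagonal `h = 0`). [cite: Greaves2001, §3.3 (the fundamental lemma applied to a sifted sequence; Corollary 1.1)] -/
theorem roughModel_sq (B : ℝ) (N m : ℕ) :
    roughModel B N m ^ 2 =
      (roughPrimorial B N : ℝ) / (Nat.totient (roughPrimorial B N) : ℝ) * roughModel B N m := by
  unfold roughModel
  split_ifs <;> ring

/-- **The pair-correlation sum IS a sifted count**:
`∑_{M₁<m≤M₁+M} g(m) g(m+h) = (P/φ(P))² · #{1 ≤ n ≤ M : ((n+M₁)(n+M₁+h), P) = 1}`.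
[cite: Greaves2001, §3.3 (the fundamental lemma applied to a sifted sequence; Corollary 1.1)] -/
theorem pairCorrelation_eq_card (B : ℝ) (N M₁ M h : ℕ) :
    ∑ m ∈ Ioc M₁ (M₁ + M), roughModel B N m * roughModel B N (m + h) =
      ((roughPrimorial B N : ℝ) / (Nat.totient (roughPrimorial B N) : ℝ)) ^ 2 *
        (#((Ioc 0 M).filter fun n : ℕ =>
          ((shiftPairPoly M₁ h).eval (n : ℤ)).natAbs.Coprime (roughPrimorial B N)) : ℝ) := by
  set P := roughPrimorial B N with hP
  -- shift the summation variable `m = n + M₁`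
  have hshift : ∑ m ∈ Ioc M₁ (M₁ + M), roughModel B N m * roughModel B N (m + h) =
      ∑ n ∈ Ioc 0 M, roughModel B N (n + M₁) * roughModel B N (n + M₁ + h) := by
    rw [show Ioc M₁ (M₁ + M) = Ioc (0 + M₁) (M + M₁) by rw [zero_add, add_comm],
      ← Finset.map_add_right_Ioc 0 M M₁, Finset.sum_map]
    simp only [addRightEmbedding_apply]
  rw [hshift, Finset.sum_congr rfl fun n _ => roughModel_mul_roughModel_eq B N (n + M₁) (n + M₁ + h),
    Finset.sum_ite, Finset.sum_const_zero, add_zero, Finset.sum_const, nsmul_eq_mul, mul_comm]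
  congr 2
  exact congr_arg _ (Finset.filter_congr fun n _ => by rw [natAbs_shiftPairPoly_eval])

/-- For odd `h` and `z > 2` every term vanishes (`2 ∣ P` and `m(m+h)` is even).
[cite: Greaves2001, §3.3 (the fundamental lemma applied to a sifted sequence; Corollary 1.1)] -/
theorem pairCorrelation_eq_zero_of_odd (B : ℝ) (N M₁ M : ℕ) {h : ℕ} (hh : Odd h)
    (hz : 2 < roughLevel B N) :
    ∑ m ∈ Ioc M₁ (M₁ + M), roughModel B N m * roughModel B N (m + h) = 0 := by
  refine Finset.sum_eq_zero fun m _ => ?_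
  rw [roughModel_mul_roughModel_eq, if_neg]
  have h2P : 2 ∣ roughPrimorial B N := (dvd_primesProdBelow_iff Nat.prime_two _).mpr hz
  have h2m : 2 ∣ m * (m + h) := by
    rcases Nat.even_or_odd m with hm | hm
    · exact (even_iff_two_dvd.mp hm).mul_right _
    · exact Dvd.dvd.mul_left (even_iff_two_dvd.mp (hm.add_odd hh)) _
  intro hcop
  exact Nat.prime_two.not_dvd_one ((Nat.coprime_iff_gcd_eq_one.mp hcop) ▸ Nat.dvd_gcd h2m h2P)

/-! ### The two-sided asymptotic -/

/-- **Pair correlations of the rough model by the fundamental lemma** (explicit form, every shift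
`h ≥ 0`, every interval): for `z = (log N)^B` with `2 ≤ z ≤ D`,
`|∑_{M₁<m≤M₁+M} g_z(m) g_z(m+h) − M 𝔖_z(h)| ≤ C_ω M 𝔖_z(h) e^{−log D/log z} + z² · D e⁸ log² z`,
`C_ω = flConst 2 (2e^{17+12/log 2})`. For even `h` this is the two-sided fundamental lemma
(`abs_card_coprime_sub_le`) for `{(n+M₁)(n+M₁+h) : 1 ≤ n ≤ M}` (dimension `2`, `ω(2) = 1`) multiplied
by `(P/φ(P))² ≤ z²`; for odd `h` both the sum and `𝔖_z(h)` vanish when `z > 2`, and for `z = 2`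
(`P = 1`, `g ≡ 1`) both equal `M`. [cite: HalberstamRichert1974, Theorem 2.5 (fundamental lemma) and (1.4.14) (the product P/φ(P))] -/
theorem abs_pairCorrelation_sub_le (B : ℝ) (N M₁ M h : ℕ) {D : ℝ} (hz : 2 ≤ roughLevel B N)
    (hzD : roughLevel B N ≤ D) :
    |∑ m ∈ Ioc M₁ (M₁ + M), roughModel B N m * roughModel B N (m + h) -
        M * pairSingSeries B N h| ≤
      SieveSequence.flConst 2 (2 * Real.exp (17 + 12 / Real.log 2)) * M * pairSingSeries B N h *
          Real.exp (-(Real.log D / Real.log (roughLevel B N))) +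
        roughLevel B N ^ 2 * (D * (Real.exp 8 * Real.log (roughLevel B N) ^ 2)) := by
  set z : ℝ := roughLevel B N with hzdef
  set Cω : ℝ := SieveSequence.flConst 2 (2 * Real.exp (17 + 12 / Real.log 2)) with hCω
  have hCω0 : 0 < Cω := SieveSequence.flConst_pos (by norm_num) (by positivity)
  have hP : roughPrimorial B N = primesProdBelow z := rfl
  set r : ℝ := (primesProdBelow z : ℝ) / (Nat.totient (primesProdBelow z) : ℝ) with hr
  have hr0 : 0 ≤ r := by positivity
  have hrz : r ≤ z := primesProdBelow_div_totient_le hz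
  have hz0 : 0 < z := by linarith
  have hD0 : 0 ≤ D := by linarith
  have h𝔖0 : 0 ≤ pairSingSeries B N h := pairSingSeries_nonneg B N h
  have hRHS0 : 0 ≤ Cω * M * pairSingSeries B N h * Real.exp (-(Real.log D / Real.log z)) +
      z ^ 2 * (D * (Real.exp 8 * Real.log z ^ 2)) := by positivity
  rcases Nat.even_or_odd h with hh | hh
  · -- even `h`: the fundamental lemma for `(n + M₁)(n + M₁ + h)`
    have h2f := polyRootCountMod_shiftPairPoly_two_le_one M₁ hh
    have hlef : ∀ p : ℕ, p.Prime → polyRootCountMod ![shiftPairPoly M₁ h] p ≤ 2 :=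
      fun p hp => polyRootCountMod_shiftPairPoly_le_two M₁ h hp
    have hFL := abs_card_coprime_sub_le h2f hlef (N := M) hz hzD (shiftPairPoly_eval_pos M₁ h M)
    rw [← hCω] at hFL
    set V : ℝ := ∏ p ∈ Nat.primesBelow ⌈z⌉₊, (1 - (polyRootCountMod ![shiftPairPoly M₁ h] p : ℝ) / p)
      with hV
    set Sc : ℝ := (#((Ioc 0 M).filter fun n : ℕ =>
      ((shiftPairPoly M₁ h).eval (n : ℤ)).natAbs.Coprime (primesProdBelow z)) : ℝ) with hSc
    have hV' : V = ∏ p ∈ Nat.primesBelow ⌈z⌉₊, (1 - (pairShiftRootCount h p : ℝ) / p) :=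
      Finset.prod_congr rfl fun p hp => by
        rw [polyRootCountMod_shiftPairPoly M₁ h (Nat.prime_of_mem_primesBelow hp)]
    have h𝔖 : pairSingSeries B N h = r ^ 2 * V := by rw [pairSingSeries, hP, hV']
    have hsum : ∑ m ∈ Ioc M₁ (M₁ + M), roughModel B N m * roughModel B N (m + h) = r ^ 2 * Sc := by
      rw [pairCorrelation_eq_card, hP]
    rw [hsum, h𝔖]
    have hE0 : 0 ≤ D * (Real.exp 8 * Real.log z ^ 2) := by positivity
    calc |r ^ 2 * Sc - (M : ℝ) * (r ^ 2 * V)| = r ^ 2 * |Sc - M * V| := by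
          rw [show r ^ 2 * Sc - (M : ℝ) * (r ^ 2 * V) = r ^ 2 * (Sc - M * V) by ring, abs_mul,
            abs_of_nonneg (sq_nonneg r)]
      _ ≤ r ^ 2 * (Cω * M * V * Real.exp (-(Real.log D / Real.log z)) +
            D * (Real.exp 8 * Real.log z ^ 2)) := mul_le_mul_of_nonneg_left hFL (sq_nonneg r)
      _ = Cω * M * (r ^ 2 * V) * Real.exp (-(Real.log D / Real.log z)) +
            r ^ 2 * (D * (Real.exp 8 * Real.log z ^ 2)) := by ring
      _ ≤ Cω * M * (r ^ 2 * V) * Real.exp (-(Real.log D / Real.log z)) +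
            z ^ 2 * (D * (Real.exp 8 * Real.log z ^ 2)) := by
          gcongr
  · -- odd `h`: both sides vanish
    suffices h0 : ∑ m ∈ Ioc M₁ (M₁ + M), roughModel B N m * roughModel B N (m + h) =
        M * pairSingSeries B N h by
      rw [h0, sub_self, abs_zero]; exact hRHS0
    rcases lt_or_eq_of_le hz with hz2 | hz2
    · rw [pairCorrelation_eq_zero_of_odd B N M₁ M hh hz2, pairSingSeries_eq_zero_of_odd B N hh hz2,
        mul_zero]
    · -- `z = 2`: `P = 1`, `g ≡ 1`, `𝔖 = 1`
      have hceil : ⌈z⌉₊ = 2 := by rw [← hz2]; norm_num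
      have hempty : Nat.primesBelow ⌈z⌉₊ = ∅ := by
        rw [hceil]; decide
      have hP1 : roughPrimorial B N = 1 := by
        rw [hP, primesProdBelow, hempty, Finset.prod_empty]
      have hg : ∀ m, roughModel B N m = 1 := fun m => by
        rw [roughModel, hP1, if_pos (Nat.coprime_one_right m)]; simp
      have h𝔖 : pairSingSeries B N h = 1 := by
        rw [pairSingSeries, hP1, ← hzdef, hempty]; simp
      simp [hg, h𝔖]

/-- **Pair correlations of the rough model** (packaged form): there is an absolute `C > 0` such that
for all `N, M₁, M, h` and `D ≥ z = (log N)^B ≥ 2`,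
`|∑_{M₁<m≤M₁+M} g_z(m) g_z(m+h) − M 𝔖_z(h)| ≤ C·(M 𝔖_z(h) e^{−log D/log z} + D z⁴)`
(`log² z ≤ z²`). With `D = N^{1/2}`, `z = (log N)^B`: error `≪ M𝔖_z(h) N^{−1/(2B log log N)} + N^{1/2}(log N)^{4B}`.
[cite: HalberstamRichert1974, Theorem 2.5 (fundamental lemma) and (1.4.14) (the product P/φ(P))] -/
theorem exists_pairCorrelation_bound (B : ℝ) :
    ∃ C : ℝ, 0 < C ∧ ∀ (N M₁ M h : ℕ) (D : ℝ), 2 ≤ roughLevel B N → roughLevel B N ≤ D →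
      |∑ m ∈ Ioc M₁ (M₁ + M), roughModel B N m * roughModel B N (m + h) -
          M * pairSingSeries B N h| ≤
        C * ((M : ℝ) * pairSingSeries B N h * Real.exp (-(Real.log D / Real.log (roughLevel B N))) +
          D * roughLevel B N ^ 4) := by
  set Cω : ℝ := SieveSequence.flConst 2 (2 * Real.exp (17 + 12 / Real.log 2)) with hCω
  have hCω0 : 0 < Cω := SieveSequence.flConst_pos (by norm_num) (by positivity)
  refine ⟨max Cω (Real.exp 8), lt_max_of_lt_left hCω0, fun N M₁ M h D hz hzD => ?_⟩
  have hmain := abs_pairCorrelation_sub_le B N M₁ M h hz hzD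
  rw [← hCω] at hmain
  set z : ℝ := roughLevel B N with hzdef
  have hz0 : 0 < z := by linarith
  have hD0 : 0 ≤ D := by linarith
  have hlogz : Real.log z ^ 2 ≤ z ^ 2 := by
    have h0 : 0 ≤ Real.log z := Real.log_nonneg (by linarith)
    have h1 : Real.log z ≤ z := Real.log_le_self hz0.le
    nlinarith
  have h𝔖0 : 0 ≤ pairSingSeries B N h := pairSingSeries_nonneg B N h
  have hA : Cω * M * pairSingSeries B N h * Real.exp (-(Real.log D / Real.log z)) ≤
      max Cω (Real.exp 8) * ((M : ℝ) * pairSingSeries B N h * Real.exp (-(Real.log D / Real.log z))) := by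
    rw [show Cω * M * pairSingSeries B N h * Real.exp (-(Real.log D / Real.log z)) =
      Cω * ((M : ℝ) * pairSingSeries B N h * Real.exp (-(Real.log D / Real.log z))) by ring]
    exact mul_le_mul_of_nonneg_right (le_max_left _ _) (by positivity)
  have hB : z ^ 2 * (D * (Real.exp 8 * Real.log z ^ 2)) ≤ max Cω (Real.exp 8) * (D * z ^ 4) := by
    calc z ^ 2 * (D * (Real.exp 8 * Real.log z ^ 2)) = Real.exp 8 * (D * (z ^ 2 * Real.log z ^ 2)) := by
          ring
      _ ≤ Real.exp 8 * (D * (z ^ 2 * z ^ 2)) := by gcongr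
      _ = Real.exp 8 * (D * z ^ 4) := by ring
      _ ≤ max Cω (Real.exp 8) * (D * z ^ 4) :=
          mul_le_mul_of_nonneg_right (le_max_right _ _) (by positivity)
  calc _ ≤ _ := hmain
    _ ≤ max Cω (Real.exp 8) * ((M : ℝ) * pairSingSeries B N h * Real.exp (-(Real.log D / Real.log z))) +
          max Cω (Real.exp 8) * (D * z ^ 4) := add_le_add hA hB
    _ = _ := by ring

/-! ### Dispersion bookkeeping: the divisor expansion of `𝔖_z(h)` and the class-sum rearrangement

Appended 2026-08-27 (parity-ideate lit g13, W6).  For the variance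
`∑_n (∑_k w(k) g(n−k))² = ∑_{k,k'} w(k) w(k') ∑_n g(n−k) g(n−k')` of the dispersion argument
(route `GoldbachHeathBrownDispersion`, crux ModelDispersion) one expands the pair singular series
over the ODD square-free `d ∣ P(z)`: `𝔖_z(h) = 𝟙[2∣h] · 2 ∏_{2<p<z} p(p−2)/(p−1)² · ∑_{d ∣ (h, P'), d odd} 1/φ₂(d)`,
`φ₂(d) = ∏_{p∣d}(p−2)` [HalberstamRichert1974, (1.4.14) and Ch. 10 §1 (the twin-prime singular series as a
divisor sum)], and then `∑_{k,k'} w(k)w(k') 𝟙[k ≡ k' (2d)] = ∑_{r mod 2d} (∑_{k≡r} w(k))² ≥ 0` class by class.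
We index the divisor sum by the SUBSETS `t` of the odd primes below `z` (`d = ∏_{p∈t} p`,
`prod_primes_dvd_iff_forall`). -/

/-- `∏_{p∈S}(1 + 𝟙[p∣h] a_p) = ∑_{t ⊆ S} 𝟙[every p ∈ t divides h] ∏_{p∈t} a_p`.
[cite: HalberstamRichert1974, Ch. 1 (1.4.14) (expanding a product over primes into a divisor sum)] -/
theorem prod_one_add_ite_dvd_eq_sum_powerset (S : Finset ℕ) (a : ℕ → ℝ) (h : ℕ) :
    ∏ p ∈ S, (1 + if p ∣ h then a p else 0) =
      ∑ t ∈ S.powerset, if (∀ p ∈ t, p ∣ h) then ∏ p ∈ t, a p else 0 := by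
  rw [Finset.prod_one_add]
  exact Finset.sum_congr rfl fun t _ => Finset.prod_ite_zero

/-- For a set `t` of primes, `∏_{p∈t} p ∣ h ↔ every p ∈ t divides h` (divisor bookkeeping of the
expansion). [cite: HalberstamRichert1974, Ch. 1 (1.4.14) (expanding a product over primes into a divisor sum)] -/
theorem prod_primes_dvd_iff_forall {t : Finset ℕ} (ht : ∀ p ∈ t, p.Prime) (h : ℕ) :
    (∏ p ∈ t, p) ∣ h ↔ ∀ p ∈ t, p ∣ h := by
  constructor
  · intro hd p hp
    exact (Finset.dvd_prod_of_mem (fun q : ℕ => q) hp).trans hd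
  · intro hall
    exact Finset.prod_primes_dvd h (fun p hp => Nat.prime_iff.mp (ht p hp)) hall

/-- The odd primes below `z`. [cite: HalberstamRichert1974, Ch. 10 §1 (the odd part of the sifting range for the twin-prime problem)] -/
def oddPrimesBelow (z : ℝ) : Finset ℕ := (Nat.primesBelow ⌈z⌉₊).erase 2

/-- Members of `oddPrimesBelow z` are primes `≠ 2` below `z`. [cite: HalberstamRichert1974, Ch. 10 §1 (the odd part of the sifting range for the twin-prime problem)] -/
theorem mem_oddPrimesBelow {z : ℝ} {p : ℕ} :
    p ∈ oddPrimesBelow z ↔ p ≠ 2 ∧ p ∈ Nat.primesBelow ⌈z⌉₊ := by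
  rw [oddPrimesBelow, Finset.mem_erase]

/-- The `h`-independent constant `2 ∏_{2<p<z} p(p−2)/(p−1)²` of the expansion.
[cite: HalberstamRichert1974, Ch. 10 §1 (the twin-prime constant as a product over odd primes)] -/
def pairSingConst (B : ℝ) (N : ℕ) : ℝ :=
  2 * ∏ p ∈ oddPrimesBelow (roughLevel B N), ((p : ℝ) * ((p : ℝ) - 2) / ((p : ℝ) - 1) ^ 2)

/-- `0 < pairSingConst`. [cite: HalberstamRichert1974, Ch. 10 §1 (the twin-prime constant as a product over odd primes)] -/
theorem pairSingConst_pos (B : ℝ) (N : ℕ) : 0 < pairSingConst B N := by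
  refine mul_pos two_pos (Finset.prod_pos fun p hp => ?_)
  obtain ⟨hp2, hp⟩ := mem_oddPrimesBelow.mp hp
  have hpp := Nat.prime_of_mem_primesBelow hp
  have h3 : (3 : ℝ) ≤ p := by
    have : 3 ≤ p := by
      rcases hpp.eq_two_or_odd' with h | h
      · exact absurd h hp2
      · have := hpp.two_le; rcases h with ⟨k, hk⟩; omega
    exact_mod_cast this
  have h1 : 0 < ((p : ℝ) - 1) ^ 2 := pow_pos (by linarith) 2
  exact div_pos (mul_pos (by linarith) (by linarith)) h1

/-- **The divisor expansion of the pair singular series** (for `z > 2`):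
`𝔖_z(h) = 𝟙[2∣h] · pairSingConst · ∑_{t ⊆ oddPrimesBelow z} 𝟙[∀ p ∈ t, p ∣ h] ∏_{p∈t} 1/(p−2)`,
i.e. `𝔖_z(h) = 𝟙[2∣h] · 2∏_{2<p<z} p(p−2)/(p−1)² · ∑_{d ∣ (h, P')} 1/φ₂(d)` with `d = ∏ t` running over the
odd square-free `d ∣ P(z)`. [cite: HalberstamRichert1974, Ch. 10 §1 with (1.4.14) (the twin-prime singular series as a divisor sum)] -/
theorem pairSingSeries_eq_sum_powerset (B : ℝ) (N h : ℕ) (hz : 2 < roughLevel B N) :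
    pairSingSeries B N h =
      (if 2 ∣ h then (1 : ℝ) else 0) * pairSingConst B N *
        ∑ t ∈ (oddPrimesBelow (roughLevel B N)).powerset,
          if (∀ p ∈ t, p ∣ h) then ∏ p ∈ t, (1 / ((p : ℝ) - 2)) else 0 := by
  rw [pairSingSeries_eq_prod, ← prod_one_add_ite_dvd_eq_sum_powerset, pairSingConst, oddPrimesBelow]
  have h2 : 2 ∈ Nat.primesBelow ⌈roughLevel B N⌉₊ :=
    Nat.mem_primesBelow.mpr ⟨Nat.lt_ceil.mpr (by exact_mod_cast hz), Nat.prime_two⟩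
  rw [← Finset.mul_prod_erase _ _ h2]
  have hfac2 : (if 2 ∣ h then (2 : ℝ) / ((2 : ℝ) - 1) else 1 - 1 / ((2 : ℝ) - 1) ^ 2) =
      (if 2 ∣ h then (1 : ℝ) else 0) * 2 := by
    split_ifs <;> norm_num
  push_cast
  rw [hfac2]
  have hprod : ∏ p ∈ (Nat.primesBelow ⌈roughLevel B N⌉₊).erase 2,
      (if p ∣ h then (p : ℝ) / ((p : ℝ) - 1) else 1 - 1 / ((p : ℝ) - 1) ^ 2) =
      ∏ p ∈ (Nat.primesBelow ⌈roughLevel B N⌉₊).erase 2,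
        ((p : ℝ) * ((p : ℝ) - 2) / ((p : ℝ) - 1) ^ 2 * (1 + if p ∣ h then 1 / ((p : ℝ) - 2) else 0)) := by
    refine Finset.prod_congr rfl fun p hp => ?_
    obtain ⟨hp2, hp'⟩ := Finset.mem_erase.mp hp
    have hpp := Nat.prime_of_mem_primesBelow hp'
    have h3 : (3 : ℝ) ≤ p := by
      have : 3 ≤ p := by
        rcases hpp.eq_two_or_odd' with h | h
        · exact absurd h hp2
        · have := hpp.two_le; rcases h with ⟨k, hk⟩; omega
      exact_mod_cast this
    have hp1 : (p : ℝ) - 1 ≠ 0 := by linarith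
    have hp2' : (p : ℝ) - 2 ≠ 0 := by linarith
    split_ifs
    · field_simp
      ring
    · field_simp
      ring
  rw [hprod, Finset.prod_mul_distrib]
  ring

/-- For a set `t` of odd primes below `z`: `2∏_{p∈t} p ∣ h ↔ 2 ∣ h ∧ every p ∈ t divides h` (the
modulus of the class rearrangement attached to the term `t` of the expansion).
[cite: HalberstamRichert1974, Ch. 10 §1 with (1.4.14) (the twin-prime singular series as a divisor sum)] -/
theorem two_mul_prod_dvd_iff {z : ℝ} {t : Finset ℕ} (ht : t ⊆ oddPrimesBelow z) (h : ℕ) :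
    2 * (∏ p ∈ t, p) ∣ h ↔ 2 ∣ h ∧ ∀ p ∈ t, p ∣ h := by
  have hprime : ∀ p ∈ t, p.Prime := fun p hp =>
    Nat.prime_of_mem_primesBelow (mem_oddPrimesBelow.mp (ht hp)).2
  have hcop : Nat.Coprime 2 (∏ p ∈ t, p) := by
    refine Nat.Coprime.prod_right fun p hp => ?_
    have hp2 : p ≠ 2 := (mem_oddPrimesBelow.mp (ht hp)).1
    exact (Nat.coprime_primes Nat.prime_two (hprime p hp)).mpr (Ne.symm hp2)
  rw [← prod_primes_dvd_iff_forall hprime]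
  constructor
  · intro hd
    exact ⟨(dvd_mul_right 2 _).trans hd, (dvd_mul_left _ 2).trans hd⟩
  · rintro ⟨h2, hd⟩
    exact hcop.mul_dvd_of_dvd_of_dvd h2 hd

/-- **Rearranging a bilinear form by residue classes**: for `0 < m`,
`∑_{k,k' ∈ K} w(k) w(k') 𝟙[k ≡ k' (mod m)] = ∑_{r<m} (∑_{k∈K, k≡r (m)} w(k))²` (in particular `≥ 0`).
[cite: BombieriFriedlanderIwaniecActa1986, §3 (the dispersion method: opening the square and collecting residue classes)] -/
theorem sum_sum_mul_ite_modEq_eq_sum_sq (K : Finset ℕ) (w : ℕ → ℝ) {m : ℕ} (hm : 0 < m) :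
    ∑ k ∈ K, ∑ k' ∈ K, w k * w k' * (if k ≡ k' [MOD m] then 1 else 0) =
      ∑ r ∈ range m, (∑ k ∈ K.filter (fun k : ℕ => k ≡ r [MOD m]), w k) ^ 2 := by
  have hrhs : ∀ r ∈ range m, (∑ k ∈ K.filter (fun k : ℕ => k ≡ r [MOD m]), w k) ^ 2 =
      ∑ k ∈ K, ∑ k' ∈ K, (if k % m = r then w k else 0) * (if k' % m = r then w k' else 0) := by
    intro r hr
    rw [Finset.mem_range] at hr
    have hfilt : ∑ k ∈ K.filter (fun k : ℕ => k ≡ r [MOD m]), w k = ∑ k ∈ K, if k % m = r then w k else 0 := by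
      rw [Finset.sum_filter]
      refine Finset.sum_congr rfl fun k _ => ?_
      have : (k ≡ r [MOD m]) ↔ k % m = r := by
        rw [Nat.ModEq, Nat.mod_eq_of_lt hr]
      simp only [this]
    rw [hfilt, sq, Finset.sum_mul_sum]
  symm
  rw [Finset.sum_congr rfl hrhs, Finset.sum_comm]
  refine Finset.sum_congr rfl fun k _ => ?_
  rw [Finset.sum_comm]
  refine Finset.sum_congr rfl fun k' _ => ?_
  -- `∑_{r<m} [k%m = r][k'%m = r] w w' = w w' [k ≡ k']`
  have hk : k % m ∈ range m := Finset.mem_range.mpr (Nat.mod_lt _ hm)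
  have hterm : ∀ r ∈ range m, (if k % m = r then w k else 0) * (if k' % m = r then w k' else 0) =
      if k % m = r then (if k' % m = r then w k * w k' else 0) else 0 := by
    intro r _
    split_ifs <;> simp
  rw [Finset.sum_congr rfl hterm, Finset.sum_ite_eq, if_pos hk]
  by_cases hkk : k' % m = k % m
  · have hkk' : k ≡ k' [MOD m] := hkk.symm
    rw [if_pos hkk, if_pos hkk', mul_one]
  · have hkk' : ¬ k ≡ k' [MOD m] := fun h => hkk h.symm
    rw [if_neg hkk, if_neg hkk', mul_zero]

/-- `∑_{k,k'} w(k)w(k') 𝟙[k ≡ k' (mod m)] ≥ 0`. [cite: BombieriFriedlanderIwaniecActa1986, §3 (the dispersion method: opening the square and collecting residue classes)] -/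
theorem sum_sum_mul_ite_modEq_nonneg (K : Finset ℕ) (w : ℕ → ℝ) {m : ℕ} (hm : 0 < m) :
    0 ≤ ∑ k ∈ K, ∑ k' ∈ K, w k * w k' * (if k ≡ k' [MOD m] then 1 else 0) := by
  rw [sum_sum_mul_ite_modEq_eq_sum_sq K w hm]
  exact Finset.sum_nonneg fun r _ => sq_nonneg _

end Literature.NumberTheory.Sieve.CubicMinorant

end
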